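import Mathlib
import HarnessLib

/-!
# The Kronrod scheme: Stieltjes polynomials and the Gauss–Kronrod rules of lowest order
(Davis–Rabinowitz, *Methods of Numerical Integration*, 2nd ed. 1984, Sect. 2.7.1.1)

## The text

Sect. 2.7.1.1 "The Kronrod Scheme": starting from the `n`-point Gauss rule `G_n` (Legendre case, `w ≡ 1` on
`[-1, 1]`, nodes = the zeros `y_1, …, y_n` of the Legendre polynomial `p_n`), Kronrod adds the `n + 1` zeros
`x_1, …, x_{n+1}` of the Stieltjes polynomial `E_n ∈ 𝒫_{n+1}` of (2.7.1.1.1), which is orthogonal to `𝒫_n` with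
respect to the oscillatory weight factor `p_n`:
`∫_{-1}^{1} p_n(x) E_n(x) x^k dx = 0, 0 ≤ k ≤ n` (2.7.1.1.6).
THEOREM (Szegő): the zeros of `E_n` are real, simple, interior to `[-1, 1]` and separated by the zeros of `p_n`.
By the first theorem of Sect. 2.7.1 the rule on the combined `2n + 1` abscissas
`∫_{-1}^{1} f ≈ Σ a_k f(y_k) + Σ b_k f(x_k)` (2.7.1.1.7)
made exact for `𝒫_{2n}` is exact for `𝒫_{3n+1}` (`𝒫_{3n+2}` if `n` is odd); the weights belonging to `G_n` are
not conserved; all weights are positive (Monegato); apart from special cases the exact degree is `3n + 1`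
(`n` even), `3n + 2` (`n` odd).

## What is recorded (the two lowest orders, in closed form, coefficientwise)

* `stieltjesE₁ = X² - 3/5`, `stieltjesE₂ = X³ - (6/7)X` — the Stieltjes polynomials for `n = 1` (`p_1 = x`) and
  `n = 2` (`p_2 = (3x² - 1)/2`) in the MONIC normalisation ((2.7.1.1.1) fixes `E_n` only up to the factor `d_n`;
  the zeros and (2.7.1.1.6) are unaffected): the orthogonality (2.7.1.1.6) against every `q ∈ 𝒫_n`
  (`integral_legendre₁_mul_stieltjesE₁_mul`, `integral_legendre₂_mul_stieltjesE₂_mul`) and the fact that (2.7.1.1.6)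
  DETERMINES the monic `E_n` (`stieltjesE₁_unique`, `stieltjesE₂_unique`).
* Szegő's theorem for these two: the zeros are `±v`, `v² = 3/5` (resp. `0, ±b`, `b² = 6/7`), distinct, inside
  `(-1, 1)`, and interlaced with the Gauss nodes `0` (resp. `±u`, `u² = 1/3`):
  `stieltjesE₁_eval_eq_zero_iff`, `stieltjesE₂_eval_eq_zero_iff`, `kronrod_nodes_interlace₁`,
  `kronrod_nodes_interlace₂`.
* `n = 1`: exactness on `𝒫_{2n} = 𝒫_2` on the abscissas `0, ±v` forces the weights `8/9, 5/9, 5/9`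
  (`kronrod₃_weights_eq`) — the Kronrod extension `K₃` of `G₁` IS the Gauss rule `G₃`, exact for `𝒫_5 = 𝒫_{3n+2}`
  (`n` odd; that exactness is the tree's `Literature.Analysis.Quadrature.integral_eq_gaussLegendreThree`, not
  restated).
* `n = 2`: the Gauss–Kronrod pair `(G₂, K₅)`: `kronrodFive u b f = (308 f(0) + 243 [f(-u) + f(u)] + 98 [f(-b) + f(b)])/495`;
  exactness on `𝒫_4` on the five abscissas forces exactly these weights (`kronrod₅_weights_eq`; in particular the
  weight at the Gauss nodes drops from `1` to `243/495` — "the weights associated with `G_n` are not conserved");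
  `K₅` is exact on `𝒫_7 = 𝒫_{3n+1}` (`integral_eq_kronrodFive`) and its defect on `𝒫_8` is `-(8/2205)·c₈`
  (`integral_sub_kronrodFive`), so the exact degree is `3n + 1 = 7` (`n` even); the weights are positive and sum
  to `2` (`kronrodFive_weights`). The irrational abscissas enter only through `u² = 1/3`, `b² = 6/7`
  (`kronrod_node_param_sq`: `u = √3/3`, `v = √15/5`, `b = √42/7`).

Not formalised here: the general construction (2.7.1.1.1)–(2.7.1.1.5) via the functions of the second kind, the
general-`n` Szegő theorem and Monegato's positivity, the Gegenbauer/Lobatto extensions, Patterson's iteration.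

## Prior art in the tree (dedup census in the deposit)

`GaussFamilyLowOrder` (G₂, G₃, R₂, L₄ closed forms), `GaussTypeExactness.exactBelow_card_add_iff` (the first theorem of
Sect. 2.7.1 in general form), `GaussLegendreQuadrature` (general Gauss–Legendre); no Kronrod / Stieltjes-polynomial
declaration exists in Mathlib or the tree. This file imports Mathlib only and restates none of them.

## Engine use

Anchor M89 of the QUAD-3 lane (shared numerical engines serving client cells; rigour lives in the verifiers; every
published number belongs to a client cell's ledger, not to the engines group): `(G₂, K₅)` — and by the same template
`(G₇, K₁₅)`, `(G₁₀, K₂₁)` — is the error-estimating pair of adaptive Gauss–Kronrod integrators (QUADPACK); a verifier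
certifies a tabulated Kronrod extension by `2n + 1` moment equations up to `𝒫_{2n}` plus the `n + 1` orthogonality
integrals (2.7.1.1.6), exactly the data recorded here for `n = 1, 2`.

## References

* [DavisRabinowitz1984] P. J. Davis, P. Rabinowitz, *Methods of Numerical Integration*, 2nd ed., Academic Press
  1984, Sect. 2.7.1.1 "The Kronrod Scheme", (2.7.1.1.1)–(2.7.1.1.7), Theorem (Szegő), Monegato's positivity.
-/

namespace Literature.Analysis.Quadrature

open MeasureTheory intervalIntegral Finset Polynomial
open scoped Real Interval

noncomputable section

/-- [folklore] `∫_a^b p = Σ_{i<n} c_i (b^{i+1} - a^{i+1})/(i+1)` for `deg p < n`. -/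
private theorem integral_eval_eq_sum₆ (p : ℝ[X]) {n : ℕ} (hn : p.natDegree < n) (a b : ℝ) :
    ∫ x in a..b, p.eval x = ∑ i ∈ range n, p.coeff i * ((b ^ (i + 1) - a ^ (i + 1)) / (i + 1)) := by
  simp_rw [eval_eq_sum_range' hn]
  rw [intervalIntegral.integral_finsetSum fun i _ => ?_]
  · refine Finset.sum_congr rfl fun i _ => ?_
    rw [intervalIntegral.integral_const_mul, integral_pow]
  · exact (continuous_const.mul (continuous_pow i)).intervalIntegrable _ _

/-- [folklore] `∫_a^b g·p = Σ_{i<n} c_i ∫_a^b g(x) x^i` for continuous `g` and `deg p < n`. -/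
private theorem integral_mul_eval_eq_sum (g : ℝ → ℝ) (hg : Continuous g) (p : ℝ[X]) {n : ℕ}
    (hn : p.natDegree < n) (a b : ℝ) :
    ∫ x in a..b, g x * p.eval x = ∑ i ∈ range n, p.coeff i * ∫ x in a..b, g x * x ^ i := by
  simp_rw [eval_eq_sum_range' hn, Finset.mul_sum]
  rw [intervalIntegral.integral_finsetSum fun i _ => ?_]
  · refine Finset.sum_congr rfl fun i _ => ?_
    rw [← intervalIntegral.integral_const_mul]
    congr 1; ext x; ring
  · exact (hg.mul (continuous_const.mul (continuous_pow i))).intervalIntegrable _ _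

/-- [folklore] `∫_a^b (x^m - c x^k) = (b^{m+1}-a^{m+1})/(m+1) - c (b^{k+1}-a^{k+1})/(k+1)`. -/
private theorem integral_pow_sub_const_mul_pow (a b c : ℝ) (m k : ℕ) :
    ∫ x in a..b, (x ^ m - c * x ^ k)
      = (b ^ (m + 1) - a ^ (m + 1)) / (m + 1) - c * ((b ^ (k + 1) - a ^ (k + 1)) / (k + 1)) := by
  rw [intervalIntegral.integral_sub ((continuous_pow m).intervalIntegrable _ _)
    ((by fun_prop : Continuous fun x : ℝ => c * x ^ k).intervalIntegrable _ _),
    intervalIntegral.integral_const_mul, integral_pow, integral_pow]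

/-! ### The Stieltjes polynomials `E₁`, `E₂` (monic normalisation) and the orthogonality (2.7.1.1.6) -/

/-- `E₁ = X² - 3/5`, the Stieltjes polynomial belonging to `p_1 = x` (monic normalisation of (2.7.1.1.1)).
[cite: DavisRabinowitz1984, Sect. 2.7.1.1 (2.7.1.1.1)] -/
def stieltjesE₁ : ℝ[X] := X ^ 2 - C (3 / 5)

/-- `E₂ = X³ - (6/7) X`, the Stieltjes polynomial belonging to `p_2 = (3x² - 1)/2` (monic normalisation of
(2.7.1.1.1)). [cite: DavisRabinowitz1984, Sect. 2.7.1.1 (2.7.1.1.1)] -/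
def stieltjesE₂ : ℝ[X] := X ^ 3 - C (6 / 7) * X

/-- [cite: DavisRabinowitz1984, Sect. 2.7.1.1 (2.7.1.1.1)] -/
theorem stieltjesE₁_eval (x : ℝ) : stieltjesE₁.eval x = x ^ 2 - 3 / 5 := by
  simp [stieltjesE₁]

/-- [cite: DavisRabinowitz1984, Sect. 2.7.1.1 (2.7.1.1.1)] -/
theorem stieltjesE₂_eval (x : ℝ) : stieltjesE₂.eval x = x ^ 3 - 6 / 7 * x := by
  simp [stieltjesE₂]

/-- [cite: DavisRabinowitz1984, Sect. 2.7.1.1 (2.7.1.1.1)] -/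
theorem natDegree_stieltjesE₁ : stieltjesE₁.natDegree = 2 := by
  unfold stieltjesE₁; compute_degree!

/-- [cite: DavisRabinowitz1984, Sect. 2.7.1.1 (2.7.1.1.1)] -/
theorem natDegree_stieltjesE₂ : stieltjesE₂.natDegree = 3 := by
  unfold stieltjesE₂; compute_degree!

/-- (2.7.1.1.6) for `n = 1`: `∫_{-1}^{1} p_1(x) E₁(x) q(x) dx = 0` for every `q ∈ 𝒫_1` (`p_1 = x`).
[cite: DavisRabinowitz1984, Sect. 2.7.1.1 (2.7.1.1.6)] -/
theorem integral_legendre₁_mul_stieltjesE₁_mul (q : ℝ[X]) (hq : q.natDegree ≤ 1) :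
    ∫ x in (-1 : ℝ)..1, x * stieltjesE₁.eval x * q.eval x = 0 := by
  have hn : q.natDegree < 2 := by omega
  rw [integral_mul_eval_eq_sum (fun x => x * stieltjesE₁.eval x)
    (by simp only [stieltjesE₁_eval]; fun_prop) q hn]
  simp only [stieltjesE₁_eval, Finset.sum_range_succ, Finset.sum_range_zero,
    show ∀ (x : ℝ) (i : ℕ), x * (x ^ 2 - 3 / 5) * x ^ i = x ^ (i + 3) - 3 / 5 * x ^ (i + 1) from
      fun x i => by ring, integral_pow_sub_const_mul_pow]
  norm_num

/-- (2.7.1.1.6) for `n = 2`: `∫_{-1}^{1} p_2(x) E₂(x) q(x) dx = 0` for every `q ∈ 𝒫_2` (`p_2 = (3x² - 1)/2`).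
[cite: DavisRabinowitz1984, Sect. 2.7.1.1 (2.7.1.1.6)] -/
theorem integral_legendre₂_mul_stieltjesE₂_mul (q : ℝ[X]) (hq : q.natDegree ≤ 2) :
    ∫ x in (-1 : ℝ)..1, (3 * x ^ 2 - 1) / 2 * stieltjesE₂.eval x * q.eval x = 0 := by
  have hn : q.natDegree < 3 := by omega
  rw [integral_mul_eval_eq_sum (fun x => (3 * x ^ 2 - 1) / 2 * stieltjesE₂.eval x)
    (by simp only [stieltjesE₂_eval]; fun_prop) q hn]
  have key : ∀ i : ℕ, ∫ x in (-1 : ℝ)..1, (3 * x ^ 2 - 1) / 2 * stieltjesE₂.eval x * x ^ i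
      = (∫ x in (-1 : ℝ)..1, (3 / 2 * x ^ (i + 5) - 25 / 14 * x ^ (i + 3)))
        + ∫ x in (-1 : ℝ)..1, 3 / 7 * x ^ (i + 1) := by
    intro i
    rw [← intervalIntegral.integral_add (Continuous.intervalIntegrable (by fun_prop) _ _)
      (Continuous.intervalIntegrable (by fun_prop) _ _)]
    congr 1; ext x; rw [stieltjesE₂_eval]; ring
  simp only [Finset.sum_range_succ, Finset.sum_range_zero, key, intervalIntegral.integral_const_mul,
    integral_pow]
  have aux : ∀ i : ℕ, ∫ x in (-1 : ℝ)..1, (3 / 2 * x ^ (i + 5) - 25 / 14 * x ^ (i + 3))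
      = 3 / 2 * ((1 ^ (i + 6) - (-1) ^ (i + 6)) / (i + 6)) - 25 / 14 * ((1 ^ (i + 4) - (-1) ^ (i + 4)) / (i + 4)) := by
    intro i
    rw [intervalIntegral.integral_sub ((by fun_prop : Continuous fun x : ℝ => 3 / 2 * x ^ (i + 5)).intervalIntegrable _ _)
      ((by fun_prop : Continuous fun x : ℝ => 25 / 14 * x ^ (i + 3)).intervalIntegrable _ _),
      intervalIntegral.integral_const_mul, intervalIntegral.integral_const_mul, integral_pow, integral_pow]
    push_cast; ring
  simp only [aux]
  norm_num

/-- (2.7.1.1.6) determines the monic `E₁`: a monic quadratic `x² + a x + c` with `∫ x (x² + a x + c) x^k = 0`,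
`k = 0, 1`, has `a = 0`, `c = -3/5`. [cite: DavisRabinowitz1984, Sect. 2.7.1.1 (2.7.1.1.6)] -/
theorem stieltjesE₁_unique {a c : ℝ}
    (h0 : ∫ x in (-1 : ℝ)..1, x * (x ^ 2 + a * x + c) = 0)
    (h1 : ∫ x in (-1 : ℝ)..1, x * (x ^ 2 + a * x + c) * x = 0) : a = 0 ∧ c = -(3 / 5) := by
  have e0 : ∫ x in (-1 : ℝ)..1, x * (x ^ 2 + a * x + c) = 2 / 3 * a := by
    have : (fun x : ℝ => x * (x ^ 2 + a * x + c)) = fun x => (X ^ 3 + C a * X ^ 2 + C c * X : ℝ[X]).eval x := by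
      ext x; simp; ring
    rw [this, integral_eval_eq_sum₆ _ (n := 4) (by compute_degree!)]
    simp [Finset.sum_range_succ, coeff_X, coeff_X_pow]
    norm_num; ring
  have e1 : ∫ x in (-1 : ℝ)..1, x * (x ^ 2 + a * x + c) * x = 2 / 5 + 2 / 3 * c := by
    have : (fun x : ℝ => x * (x ^ 2 + a * x + c) * x)
        = fun x => (X ^ 4 + C a * X ^ 3 + C c * X ^ 2 : ℝ[X]).eval x := by
      ext x; simp; ring
    rw [this, integral_eval_eq_sum₆ _ (n := 5) (by compute_degree!)]
    simp [Finset.sum_range_succ, coeff_X_pow]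
    norm_num; ring
  constructor
  · linarith [h0.symm.trans e0]
  · linarith [h1.symm.trans e1]

/-- [folklore] the three moments of `p_2 · (x³ + a x² + c x + d)` against `1, x, x²`. -/
private theorem legendre₂_cubic_moments (a c d : ℝ) :
    (∫ x in (-1 : ℝ)..1, (3 * x ^ 2 - 1) / 2 * (x ^ 3 + a * x ^ 2 + c * x + d) = 4 / 15 * a)
    ∧ (∫ x in (-1 : ℝ)..1, (3 * x ^ 2 - 1) / 2 * (x ^ 3 + a * x ^ 2 + c * x + d) * x = 8 / 35 + 4 / 15 * c)
    ∧ (∫ x in (-1 : ℝ)..1, (3 * x ^ 2 - 1) / 2 * (x ^ 3 + a * x ^ 2 + c * x + d) * x ^ 2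
        = 8 / 35 * a + 4 / 15 * d) := by
  refine ⟨?_, ?_, ?_⟩
  · have : (fun x : ℝ => (3 * x ^ 2 - 1) / 2 * (x ^ 3 + a * x ^ 2 + c * x + d)) = fun x =>
        (C (3 / 2) * X ^ 5 + C (3 / 2 * a) * X ^ 4 + C (3 / 2 * c - 1 / 2) * X ^ 3
          + C (3 / 2 * d - 1 / 2 * a) * X ^ 2 + C (-(1 / 2 * c)) * X ^ 1 + C (-(1 / 2 * d)) : ℝ[X]).eval x := by
      ext x; simp; ring
    rw [this, integral_eval_eq_sum₆ _ (n := 6) (by compute_degree!)]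
    simp only [Finset.sum_range_succ, Finset.sum_range_zero, coeff_add, coeff_C_mul_X_pow, coeff_C]
    norm_num
    try ring
  · have : (fun x : ℝ => (3 * x ^ 2 - 1) / 2 * (x ^ 3 + a * x ^ 2 + c * x + d) * x) = fun x =>
        (C (3 / 2) * X ^ 6 + C (3 / 2 * a) * X ^ 5 + C (3 / 2 * c - 1 / 2) * X ^ 4
          + C (3 / 2 * d - 1 / 2 * a) * X ^ 3 + C (-(1 / 2 * c)) * X ^ 2 + C (-(1 / 2 * d)) * X ^ 1 :
            ℝ[X]).eval x := by
      ext x; simp; ring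
    rw [this, integral_eval_eq_sum₆ _ (n := 7) (by compute_degree!)]
    simp only [Finset.sum_range_succ, Finset.sum_range_zero, coeff_add, coeff_C_mul_X_pow]
    norm_num
    try ring
  · have : (fun x : ℝ => (3 * x ^ 2 - 1) / 2 * (x ^ 3 + a * x ^ 2 + c * x + d) * x ^ 2) = fun x =>
        (C (3 / 2) * X ^ 7 + C (3 / 2 * a) * X ^ 6 + C (3 / 2 * c - 1 / 2) * X ^ 5
          + C (3 / 2 * d - 1 / 2 * a) * X ^ 4 + C (-(1 / 2 * c)) * X ^ 3 + C (-(1 / 2 * d)) * X ^ 2 :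
            ℝ[X]).eval x := by
      ext x; simp; ring
    rw [this, integral_eval_eq_sum₆ _ (n := 8) (by compute_degree!)]
    simp only [Finset.sum_range_succ, Finset.sum_range_zero, coeff_add, coeff_C_mul_X_pow]
    norm_num
    try ring

/-- (2.7.1.1.6) determines the monic `E₂`: a monic cubic `x³ + a x² + c x + d` with
`∫ p_2 (x³ + a x² + c x + d) x^k = 0`, `k = 0, 1, 2`, has `a = 0`, `c = -6/7`, `d = 0`.
[cite: DavisRabinowitz1984, Sect. 2.7.1.1 (2.7.1.1.6)] -/
theorem stieltjesE₂_unique {a c d : ℝ}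
    (h0 : ∫ x in (-1 : ℝ)..1, (3 * x ^ 2 - 1) / 2 * (x ^ 3 + a * x ^ 2 + c * x + d) = 0)
    (h1 : ∫ x in (-1 : ℝ)..1, (3 * x ^ 2 - 1) / 2 * (x ^ 3 + a * x ^ 2 + c * x + d) * x = 0)
    (h2 : ∫ x in (-1 : ℝ)..1, (3 * x ^ 2 - 1) / 2 * (x ^ 3 + a * x ^ 2 + c * x + d) * x ^ 2 = 0) :
    a = 0 ∧ c = -(6 / 7) ∧ d = 0 := by
  obtain ⟨e0, e1, e2⟩ := legendre₂_cubic_moments a c d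
  refine ⟨by linarith, by linarith, by linarith⟩

/-! ### Szegő's theorem for `E₁`, `E₂`: real simple zeros in `(-1, 1)` interlacing the Gauss nodes -/

/-- The zeros of `E₁` are `±v`, `v² = 3/5`. [cite: DavisRabinowitz1984, Sect. 2.7.1.1, Theorem (Szegő)] -/
theorem stieltjesE₁_eval_eq_zero_iff {v : ℝ} (hv : v ^ 2 = 3 / 5) (x : ℝ) :
    stieltjesE₁.eval x = 0 ↔ x = v ∨ x = -v := by
  rw [stieltjesE₁_eval, show x ^ 2 - 3 / 5 = (x - v) * (x + v) by linear_combination hv, mul_eq_zero,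
    sub_eq_zero, add_eq_zero_iff_eq_neg]

/-- The zeros of `E₂` are `0, ±b`, `b² = 6/7`. [cite: DavisRabinowitz1984, Sect. 2.7.1.1, Theorem (Szegő)] -/
theorem stieltjesE₂_eval_eq_zero_iff {b : ℝ} (hb : b ^ 2 = 6 / 7) (x : ℝ) :
    stieltjesE₂.eval x = 0 ↔ x = 0 ∨ x = b ∨ x = -b := by
  rw [stieltjesE₂_eval, show x ^ 3 - 6 / 7 * x = x * ((x - b) * (x + b)) by linear_combination x * hb,
    mul_eq_zero, mul_eq_zero, sub_eq_zero, add_eq_zero_iff_eq_neg]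

/-- Szegő's theorem, `n = 1`: the zeros `±v` of `E₁` are interior to `[-1, 1]`, distinct, and separated by the
Gauss node `y_1 = 0` of `G₁`: `-1 < -v < 0 < v < 1`. [cite: DavisRabinowitz1984, Sect. 2.7.1.1, Theorem (Szegő)] -/
theorem kronrod_nodes_interlace₁ {v : ℝ} (hv : v ^ 2 = 3 / 5) (hv0 : 0 < v) :
    -1 < -v ∧ -v < 0 ∧ (0 : ℝ) < v ∧ v < 1 := by
  have hv1 : v < 1 := by nlinarith
  exact ⟨by linarith, by linarith, hv0, hv1⟩

/-- Szegő's theorem, `n = 2`: the zeros `0, ±b` of `E₂` are interior to `[-1, 1]`, distinct, and separated by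
the Gauss nodes `±u` (`u² = 1/3`) of `G₂`: `-1 < -b < -u < 0 < u < b < 1`.
[cite: DavisRabinowitz1984, Sect. 2.7.1.1, Theorem (Szegő)] -/
theorem kronrod_nodes_interlace₂ {u b : ℝ} (hu : u ^ 2 = 1 / 3) (hu0 : 0 < u) (hb : b ^ 2 = 6 / 7)
    (hb0 : 0 < b) : -1 < -b ∧ -b < -u ∧ -u < 0 ∧ (0 : ℝ) < u ∧ u < b ∧ b < 1 := by
  have hub : u < b := by nlinarith
  have hb1 : b < 1 := by nlinarith
  exact ⟨by linarith, by linarith, by linarith, hu0, hub, hb1⟩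

/-! ### `n = 1`: the Kronrod extension of `G₁` is `G₃` -/

/-- On the abscissas `y_1 = 0`, `x_{1,2} = ±v` (`v² = 3/5`), exactness of (2.7.1.1.7) on `𝒫_{2n} = 𝒫_2` forces
the weights `a_1 = 8/9`, `b_1 = b_2 = 5/9`, i.e. `K₃ = G₃` (exact on `𝒫_5 = 𝒫_{3n+2}`, `n` odd: the tree's
`integral_eq_gaussLegendreThree`). [cite: DavisRabinowitz1984, Sect. 2.7.1.1 (2.7.1.1.7)] -/
theorem kronrod₃_weights_eq {v : ℝ} (hv : v ^ 2 = 3 / 5) {a b₁ b₂ : ℝ}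
    (h0 : a + b₁ + b₂ = ∫ _x in (-1 : ℝ)..1, (1 : ℝ))
    (h1 : b₁ * v + b₂ * (-v) = ∫ x in (-1 : ℝ)..1, x)
    (h2 : b₁ * v ^ 2 + b₂ * (-v) ^ 2 = ∫ x in (-1 : ℝ)..1, x ^ 2) :
    a = 8 / 9 ∧ b₁ = 5 / 9 ∧ b₂ = 5 / 9 := by
  have i0 : ∫ _x in (-1 : ℝ)..1, (1 : ℝ) = 2 := by simp; norm_num
  have i1 : ∫ x in (-1 : ℝ)..1, x = 0 := by rw [integral_id]; norm_num
  have i2 : ∫ x in (-1 : ℝ)..1, x ^ 2 = 2 / 3 := by rw [integral_pow]; norm_num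
  rw [i0] at h0; rw [i1] at h1; rw [i2] at h2
  have hv0 : v ≠ 0 := by rintro rfl; norm_num at hv
  have hd : (b₁ - b₂) * v = 0 := by linear_combination h1
  have hb12 : b₁ = b₂ := by
    rcases mul_eq_zero.mp hd with h | h
    · linarith
    · exact absurd h hv0
  have hs : (b₁ + b₂) * (3 / 5) = 2 / 3 := by rw [← hv]; linear_combination h2
  refine ⟨by linarith, by linarith, by linarith⟩

/-! ### `n = 2`: the Gauss–Kronrod pair `(G₂, K₅)` -/

/-- The five-point Kronrod rule `K₅` extending `G₂`: abscissas `0`, `±u` (`u² = 1/3`, the Gauss nodes) and `±b`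
(`b² = 6/7`, the zeros of `E₂` besides `0`), weights `308/495`, `243/495`, `98/495`.
[cite: DavisRabinowitz1984, Sect. 2.7.1.1 (2.7.1.1.7)] -/
def kronrodFive (u b : ℝ) (f : ℝ → ℝ) : ℝ :=
  308 / 495 * f 0 + 243 / 495 * (f (-u) + f u) + 98 / 495 * (f (-b) + f b)

/-- `K₅` is exact on `𝒫_7 = 𝒫_{3n+1}` (`n = 2`). [cite: DavisRabinowitz1984, Sect. 2.7.1.1 (2.7.1.1.7)] -/
theorem integral_eq_kronrodFive {u b : ℝ} (hu : u ^ 2 = 1 / 3) (hb : b ^ 2 = 6 / 7) (p : ℝ[X])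
    (hp : p.natDegree ≤ 7) : ∫ x in (-1 : ℝ)..1, p.eval x = kronrodFive u b (fun x => p.eval x) := by
  have hn : p.natDegree < 8 := by omega
  rw [integral_eval_eq_sum₆ p hn, kronrodFive]
  simp only [eval_eq_sum_range' hn, Finset.sum_range_succ, Finset.sum_range_zero]
  push_cast
  linear_combination (-(486 / 495) * (p.coeff 2 + p.coeff 4 * (u ^ 2 + 1 / 3)
      + p.coeff 6 * (u ^ 4 + 1 / 3 * u ^ 2 + 1 / 9))) * hu
    + (-(196 / 495) * (p.coeff 2 + p.coeff 4 * (b ^ 2 + 6 / 7)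
      + p.coeff 6 * (b ^ 4 + 6 / 7 * b ^ 2 + 36 / 49))) * hb

/-- The exact degree of `K₅` is `3n + 1 = 7`: on `𝒫_8`, `∫ p - K₅ p = -(8/2205) c₈`.
[cite: DavisRabinowitz1984, Sect. 2.7.1.1 (2.7.1.1.7)] -/
theorem integral_sub_kronrodFive {u b : ℝ} (hu : u ^ 2 = 1 / 3) (hb : b ^ 2 = 6 / 7) (p : ℝ[X])
    (hp : p.natDegree ≤ 8) :
    (∫ x in (-1 : ℝ)..1, p.eval x) - kronrodFive u b (fun x => p.eval x) = -(8 / 2205) * p.coeff 8 := by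
  have hn : p.natDegree < 9 := by omega
  rw [integral_eval_eq_sum₆ p hn, kronrodFive]
  simp only [eval_eq_sum_range' hn, Finset.sum_range_succ, Finset.sum_range_zero]
  push_cast
  linear_combination (-(486 / 495) * (p.coeff 2 + p.coeff 4 * (u ^ 2 + 1 / 3)
      + p.coeff 6 * (u ^ 4 + 1 / 3 * u ^ 2 + 1 / 9)
      + p.coeff 8 * (u ^ 6 + 1 / 3 * u ^ 4 + 1 / 9 * u ^ 2 + 1 / 27))) * hu
    + (-(196 / 495) * (p.coeff 2 + p.coeff 4 * (b ^ 2 + 6 / 7)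
      + p.coeff 6 * (b ^ 4 + 6 / 7 * b ^ 2 + 36 / 49)
      + p.coeff 8 * (b ^ 6 + 6 / 7 * b ^ 4 + 36 / 49 * b ^ 2 + 216 / 343))) * hb

/-- The `K₅` weights are positive (Monegato) and sum to `2`; the weight at the Gauss abscissas `±u` is
`243/495 ≠ 1` (the `G₂` weights are not conserved). [cite: DavisRabinowitz1984, Sect. 2.7.1.1 (2.7.1.1.7)] -/
theorem kronrodFive_weights :
    (0 : ℝ) < 308 / 495 ∧ (0 : ℝ) < 243 / 495 ∧ (0 : ℝ) < 98 / 495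
      ∧ (308 / 495 + 2 * (243 / 495) + 2 * (98 / 495) : ℝ) = 2 ∧ (243 / 495 : ℝ) ≠ 1 := by
  norm_num

/-- On the abscissas `0, ±u, ±b` (`u² = 1/3`, `b² = 6/7`, `u, b ≠ 0`) exactness of (2.7.1.1.7) on
`𝒫_{2n} = 𝒫_4` forces the `K₅` weights: `w(0) = 308/495`, `w(±u) = 243/495`, `w(±b) = 98/495`.
[cite: DavisRabinowitz1984, Sect. 2.7.1.1 (2.7.1.1.7)] -/
theorem kronrod₅_weights_eq {u b : ℝ} (hu : u ^ 2 = 1 / 3) (hb : b ^ 2 = 6 / 7) (hu0 : u ≠ 0) (hb0 : b ≠ 0)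
    {w₀ w₁ w₂ w₃ w₄ : ℝ}
    (h : ∀ k ≤ 4, w₀ * 0 ^ k + w₁ * u ^ k + w₂ * (-u) ^ k + w₃ * b ^ k + w₄ * (-b) ^ k
      = ∫ x in (-1 : ℝ)..1, x ^ k) :
    w₀ = 308 / 495 ∧ w₁ = 243 / 495 ∧ w₂ = 243 / 495 ∧ w₃ = 98 / 495 ∧ w₄ = 98 / 495 := by
  have h0 := h 0 (by norm_num); have h1 := h 1 (by norm_num); have h2 := h 2 (by norm_num)
  have h3 := h 3 (by norm_num); have h4 := h 4 (by norm_num)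
  simp only [integral_pow] at h0 h1 h2 h3 h4
  -- odd moments: `w₃ = w₄`, then `w₁ = w₂` (uses `b² - u² = 11/21 ≠ 0`, `b ≠ 0`, `u ≠ 0`)
  have hd3 : (w₃ - w₄) * b = 0 := by
    linear_combination (21 / 11) * h3 - (21 / 11) * u ^ 2 * h1 - (21 / 11) * ((w₃ - w₄) * b) * hb
      + (21 / 11) * ((w₃ - w₄) * b) * hu
  have h34 : w₃ = w₄ := by
    rcases mul_eq_zero.mp hd3 with h' | h'
    · linarith
    · exact absurd h' hb0
  have hd1 : (w₁ - w₂) * u = 0 := by linear_combination h1 - b * h34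
  have h12 : w₁ = w₂ := by
    rcases mul_eq_zero.mp hd1 with h' | h'
    · linarith
    · exact absurd h' hu0
  -- even moments: a `2 × 2` linear system for `w₁ + w₂`, `w₃ + w₄`, then `w₀`
  have hS3 : w₃ + w₄ = 196 / 495 := by
    linear_combination (49 / 22) * (h4 - 1 / 3 * h2)
      - (49 / 22) * ((w₁ + w₂) * (u ^ 2 + 1 / 3) - 1 / 3 * (w₁ + w₂)) * hu
      - (49 / 22) * ((w₃ + w₄) * (b ^ 2 + 6 / 7) - 1 / 3 * (w₃ + w₄)) * hb
  have hS1 : w₁ + w₂ = 486 / 495 := by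
    linear_combination 3 * h2 - 3 * (w₁ + w₂) * hu - 3 * (w₃ + w₄) * hb - (18 / 7) * hS3
  refine ⟨?_, ?_, ?_, ?_, ?_⟩
  · linear_combination h0 - hS1 - hS3
  · linear_combination (1 / 2) * hS1 + (1 / 2) * h12
  · linear_combination (1 / 2) * hS1 - (1 / 2) * h12
  · linear_combination (1 / 2) * hS3 + (1 / 2) * h34
  · linear_combination (1 / 2) * hS3 - (1 / 2) * h34

/-- The abscissa parameters exist: `(√3/3)² = 1/3` (Gauss nodes of `G₂`), `(√15/5)² = 3/5` (zeros of `E₁`),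
`(√42/7)² = 6/7` (outer zeros of `E₂`), all positive. [cite: DavisRabinowitz1984, Sect. 2.7.1.1 (2.7.1.1.7)] -/
theorem kronrod_node_param_sq :
    ((Real.sqrt 3 / 3) ^ 2 = 1 / 3 ∧ 0 < Real.sqrt 3 / 3) ∧ ((Real.sqrt 15 / 5) ^ 2 = 3 / 5 ∧ 0 < Real.sqrt 15 / 5)
      ∧ ((Real.sqrt 42 / 7) ^ 2 = 6 / 7 ∧ 0 < Real.sqrt 42 / 7) := by
  refine ⟨⟨?_, by positivity⟩, ⟨?_, by positivity⟩, ⟨?_, by positivity⟩⟩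
  · rw [div_pow, Real.sq_sqrt (by norm_num)]; norm_num
  · rw [div_pow, Real.sq_sqrt (by norm_num)]; norm_num
  · rw [div_pow, Real.sq_sqrt (by norm_num)]; norm_num

end

end Literature.Analysis.Quadrature
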